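import Summits.QuantumFields.YangMills.Theorems.FlatTubeReductionDiagonalRatioEventually
import Summits.QuantumFields.YangMills.Theorems.FlatTubeReductionDressedWeightOfDiagonal
import HarnessLib

/-!
# THE EXACT DRESSING, ASSEMBLED: from a profile family with the PROFILE INTERFACE (one moment number, two tails `η ≤ aλ_b²`) to the dressed weight `W̃ β = clampW κ f̂_β (min(d_tor,½))`
# with ALL five `W`-fields of `RateTube.AnalyticRatePotInput` and the (B-T)-side slack `|W̃_β² − f̂_β| ≤ ε_W(β) = O(λ_b(L³β)²)` on the slow window
# (route `FlatTubeReduction`, crux K1 `NearFlatRatioLaw` stmt-QuantumFields-24720; seat `ym-line-ftr-p1` g14; rate twin «ratepack-v3 / frozen fibres»; R2b1 RECORD rung — no summit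
# statement is proved here)

WHY (memo `Cruxes/NearFlatRatioLaw/Lines/ratepack-v3-frozen-g12.md` §§6, 6.1; this is F8b ∘ F8c).  `f̂_β(u) = f_β(u)/f_β(1)`, `f_β(u) = fpBOKernel β (Ω β) (fpWeight (ε β)) u u / K₁^{(L³β)}(u,u)`.
* ★★ `diagRatio_near_one_eventually` — F8b `fpBOKernel_diagRatio_eventually` fed with β-family hypotheses: static profile data (all `β`), FP budget `βε(β)² ≤ c_ε`, `f_β(1) > 0`,
  the moment number `Ξ_β ≤ Ξ₀` and the two tails `η(β)` on the core at `T = β^{1/8}` (the slow tail for EVERY `u` in the window), `η(β) ≤ aλ_b(L³β)²`: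
  `∃ κ ≥ 0, ε_W` with `ε_W(β) ≤ a'λ_b(L³β)²`, `0 ≤ ε_W` and `0 ≤ f̂_β(u)`, `|f̂_β(u) − 1| ≤ κ·orbitDist u² + ε_W(β)` on `{orbitDist < D·recordDelta1 L (1/6) β}` eventually;
* ★★★ `exactDressing_fields` — with `W̃ β := clampW κ f̂_β (min(d_tor,½))`: `IsPhys (W̃ β)`, `0 ≤ W̃`, `|W̃| ≤ √(1+κ/4)`, `|W̃ β u² − 1| ≤ κ·orbitDist u²` on the window (all `β`), and
  `|W̃ β u² − f̂_β u| ≤ ε_W β` on the window eventually — i.e. the fields `W, hWphys, hW0, hWbU, hκW, hWsq` of `AnalyticRatePotInput L D M` for the EXACT dressing, plus the slack the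
  (B-T) brick `hT` must absorb (`O(λ_b²)`, inside its `κ`).
HONEST FRAMING: assembly bookkeeping; the profile interface (moment number, tails, positivity) is the profile constructor's (tools: `…ReweightedProfile`, `…ReferenceMoments`,
`…ReferenceMassBounds(Mirror)`, `…CoreTails`, `…SlowReferenceTail`, `…SlowFibreTailCrude`); the other analytic fields of `AnalyticRatePotInput` (hT near/far, hODpot, hST, hN) are
open (lane A pens); femto rung R2b1 (RECORD label); not infinite volume, not a gap, not Clay.  No defs, no named facts, no `sorry`.
-/

set_option autoImplicit false

noncomputable section

open MeasureTheory Filter Topology Real Set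
open scoped BigOperators
open Literature.MathematicalPhysics.QuantumFieldTheory
open Literature.MathematicalPhysics.QuantumLattice

namespace Summit.QuantumFields.YangMills.Theorems.FemtoTransferGap.RateTube

open Summit.QuantumFields.YangMills.Theorems.FemtoTransferGap
open Summit.QuantumFields.YangMills.Theorems.FemtoTransferGap.TwoLattice
open Summit.QuantumFields.YangMills.Theorems.FemtoTransferGap.TwoLattice.ConstTube
open Summit.QuantumFields.YangMills.Theorems.FemtoTransferGap.TwoLattice.Avg
open Summit.QuantumFields.YangMills.Theorems.FemtoTransferGap.TwoLattice.Cov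
open Summit.QuantumFields.YangMills.Theorems.FemtoTransferGap.TwoLattice.Toron
open Summit.QuantumFields.YangMills.Theorems.FemtoTransferGap.TwoLattice.Stiff (LinkSpace)
open Summit.QuantumFields.YangMills.Theorems.FemtoCutoffLadder

variable {L : ℕ} [NeZero L]

set_option maxHeartbeats 800000 in
/-- ★★ **THE NORMALISED EXACT DIAGONAL RATIO IS NEAR `1`, EVENTUALLY, MODULO THE PROFILE INTERFACE.**  Profile family `Ω β` (measurable, `0 ≤ Ω β ≤ CΩ β`, colour-blind,
cap-supported — all `β`), FP windows `ε β` with `β·ε(β)² ≤ c_ε` eventually, slow window `δ₁ = D·recordDelta1 L (1/6)` (`D ≥ 0`); INTERFACE: eventually `f_β(1) > 0`, a moment number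
`0 ≤ Ξ ≤ Ξ₀` on the core at `T = β^{1/8}`, the reference tail `≤ η(β)∫ρ₁`, the slow tail `≤ η(β)·(∫ρ₁/K₁(1,1))` for every `u` in the window and every colour rotation `d`, and
`η(β) ≤ a·λ_b(L³β)²`, `0 ≤ η(β)`.  THEN `∃ κ ≥ 0, ∃ ε_W` (`0 ≤ ε_W(β) ≤ a'λ_b(L³β)²` eventually) with `0 ≤ f̂_β(u)` and `|f̂_β(u) − 1| ≤ κ·orbitDist u² + ε_W(β)` on the window
eventually. [cite: Luscher1983, §3] -/
theorem diagRatio_near_one_eventually {D cε Ξ₀ a : ℝ} (hD : 0 ≤ D) (hcε : 0 ≤ cε) (hΞ₀ : 0 ≤ Ξ₀) (Ω : ℝ → LinkSpace L → ℝ) (CΩ ε η : ℝ → ℝ)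
    (hΩm : ∀ β, Measurable (Ω β)) (hCΩ : ∀ β x, |Ω β x| ≤ CΩ β) (hΩ0 : ∀ β x, 0 ≤ Ω β x) (hΩinv : ∀ β (g : SU2) (x : LinkSpace L), Ω β (adL L g x) = Ω β x)
    (hΩc : ∀ β (v : Edge 3 L → Fin 3 → ℝ), Ω β (linkEmbed L v) ≠ 0 → v ∈ capBalancedSet L) (hε : ∀ᶠ β : ℝ in atTop, β * ε β ^ 2 ≤ cε)
    (hpos : ∀ᶠ β : ℝ in atTop, 0 < fpBOKernel L β (Ω β) (fpWeight L (ε β)) 1 1 / transferKernel su2Rep ((L : ℝ) ^ 3 * β) (1 : GaugeConfig 3 1 SU2) 1)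
    (hΞ : ∀ᶠ β : ℝ in atTop, ∃ Ξ : ℝ, 0 ≤ Ξ ∧ Ξ ≤ Ξ₀ ∧
      ∫ p in ({p : (Edge 3 L → Fin 3 → ℝ) × ((Edge 3 L → Fin 3 → ℝ) × (Site 3 L → SU2)) | β * kinDefect L (orthoTube L 1 p.1) (orthoTube L 1 p.2.1) p.2.2 ≤ β ^ ((1 : ℝ) / 8)} ∩
          {p | β * ‖linkEmbed L p.1‖ ^ 2 ≤ β ^ ((1 : ℝ) / 8)} ∩ {p | β * ‖linkEmbed L p.2.1‖ ^ 2 ≤ β ^ ((1 : ℝ) / 8)} ∩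
          {p | Ω β (linkEmbed L p.1) ≠ 0 ∧ Ω β (linkEmbed L p.2.1) ≠ 0 ∧ fpWeight L (ε β) p.2.2 ≠ 0}),
        fpTriple L β (Ω β) (fpWeight L (ε β)) 1 1 p * (1 + β * kinDefect L (orthoTube L 1 p.1) (orthoTube L 1 p.2.1) p.2.2 + β * ‖linkEmbed L p.1‖ ^ 2 + β * ‖linkEmbed L p.2.1‖ ^ 2) ^ 4
        ∂((orthoTransverse L).prod ((orthoTransverse L).prod (gaugeMeasure L))) ≤
      Ξ * ∫ p, fpTriple L β (Ω β) (fpWeight L (ε β)) 1 1 p ∂((orthoTransverse L).prod ((orthoTransverse L).prod (gaugeMeasure L))))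
    (hη1 : ∀ᶠ β : ℝ in atTop,
      ∫ p in ({p : (Edge 3 L → Fin 3 → ℝ) × ((Edge 3 L → Fin 3 → ℝ) × (Site 3 L → SU2)) | β * kinDefect L (orthoTube L 1 p.1) (orthoTube L 1 p.2.1) p.2.2 ≤ β ^ ((1 : ℝ) / 8)} ∩
          {p | β * ‖linkEmbed L p.1‖ ^ 2 ≤ β ^ ((1 : ℝ) / 8)} ∩ {p | β * ‖linkEmbed L p.2.1‖ ^ 2 ≤ β ^ ((1 : ℝ) / 8)} ∩
          {p | Ω β (linkEmbed L p.1) ≠ 0 ∧ Ω β (linkEmbed L p.2.1) ≠ 0 ∧ fpWeight L (ε β) p.2.2 ≠ 0})ᶜ,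
        fpTriple L β (Ω β) (fpWeight L (ε β)) 1 1 p ∂((orthoTransverse L).prod ((orthoTransverse L).prod (gaugeMeasure L))) ≤
      η β * ∫ p, fpTriple L β (Ω β) (fpWeight L (ε β)) 1 1 p ∂((orthoTransverse L).prod ((orthoTransverse L).prod (gaugeMeasure L))))
    (hηu : ∀ᶠ β : ℝ in atTop, ∀ u : GaugeConfig 3 1 SU2, orbitDist u < D * recordDelta1 L (1 / 6) β → ∀ d : SU2,
      (∫ p in ({p : (Edge 3 L → Fin 3 → ℝ) × ((Edge 3 L → Fin 3 → ℝ) × (Site 3 L → SU2)) | β * kinDefect L (orthoTube L 1 p.1) (orthoTube L 1 p.2.1) p.2.2 ≤ β ^ ((1 : ℝ) / 8)} ∩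
          {p | β * ‖linkEmbed L p.1‖ ^ 2 ≤ β ^ ((1 : ℝ) / 8)} ∩ {p | β * ‖linkEmbed L p.2.1‖ ^ 2 ≤ β ^ ((1 : ℝ) / 8)} ∩
          {p | Ω β (linkEmbed L p.1) ≠ 0 ∧ Ω β (linkEmbed L p.2.1) ≠ 0 ∧ fpWeight L (ε β) p.2.2 ≠ 0})ᶜ,
        fpTriple L β (Ω β) (fpWeight L (ε β)) (gaugeTransform (fun _ : Site 3 1 => d) u) (gaugeTransform (fun _ : Site 3 1 => d) u) p
        ∂((orthoTransverse L).prod ((orthoTransverse L).prod (gaugeMeasure L)))) / transferKernel su2Rep ((L : ℝ) ^ 3 * β) u u ≤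
      η β * ((∫ p, fpTriple L β (Ω β) (fpWeight L (ε β)) 1 1 p ∂((orthoTransverse L).prod ((orthoTransverse L).prod (gaugeMeasure L)))) /
        transferKernel su2Rep ((L : ℝ) ^ 3 * β) (1 : GaugeConfig 3 1 SU2) 1))
    (hη0 : ∀ᶠ β : ℝ in atTop, 0 ≤ η β) (hηa : ∀ᶠ β : ℝ in atTop, η β ≤ a * bareLambda ((L : ℝ) ^ 3 * β) ^ 2) :
    ∃ κ : ℝ, 0 ≤ κ ∧ ∃ εW : ℝ → ℝ, (∃ a' : ℝ, ∀ᶠ β : ℝ in atTop, εW β ≤ a' * bareLambda ((L : ℝ) ^ 3 * β) ^ 2) ∧ (∀ᶠ β : ℝ in atTop, 0 ≤ εW β) ∧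
      ∀ᶠ β : ℝ in atTop, ∀ u : GaugeConfig 3 1 SU2, orbitDist u < D * recordDelta1 L (1 / 6) β →
        0 ≤ fpBOKernel L β (Ω β) (fpWeight L (ε β)) u u / transferKernel su2Rep ((L : ℝ) ^ 3 * β) u u /
            (fpBOKernel L β (Ω β) (fpWeight L (ε β)) 1 1 / transferKernel su2Rep ((L : ℝ) ^ 3 * β) (1 : GaugeConfig 3 1 SU2) 1) ∧
        |fpBOKernel L β (Ω β) (fpWeight L (ε β)) u u / transferKernel su2Rep ((L : ℝ) ^ 3 * β) u u /
            (fpBOKernel L β (Ω β) (fpWeight L (ε β)) 1 1 / transferKernel su2Rep ((L : ℝ) ^ 3 * β) (1 : GaugeConfig 3 1 SU2) 1) - 1| ≤ κ * orbitDist u ^ 2 + εW β := by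
  obtain ⟨κ, C, hκ, hC, hev⟩ := fpBOKernel_diagRatio_eventually (L := L) hD hcε hΞ₀
  refine ⟨κ, hκ, fun β => C * β ^ (-((3 : ℝ) / 4)) + η β, ⟨C * (L : ℝ) ^ 2 + a, ?_⟩, ?_, ?_⟩
  · filter_upwards [hηa, Filter.eventually_ge_atTop (1 : ℝ)] with β hβ hβ1
    have h := rpow_neg_three_quarters_le_bareLambda_sq (L := L) hβ1
    nlinarith [h, hβ, hC]
  · filter_upwards [hη0, Filter.eventually_gt_atTop (0 : ℝ)] with β hβ hβ0
    have := Real.rpow_pos_of_pos hβ0 (-((3 : ℝ) / 4))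
    positivity
  · filter_upwards [hev, hε, hpos, hΞ, hη1, hηu] with β hβ hεβ hposβ hΞβ hη1β hηuβ u hu
    obtain ⟨Ξ, hΞ0, hΞ1, hΞb⟩ := hΞβ
    obtain ⟨-, -, hrat⟩ := hβ (hΩm β) (hCΩ β) (hΩ0 β) (hΩinv β) (hΩc β) (ε β) hεβ u hu hΞ0 hΞ1 hΞb hη1β (hηuβ u hu)
    refine ⟨div_nonneg (diagRatio_nonneg β (hΩm β) (hCΩ β) (hΩ0 β) (measurable_fpWeight L (ε β)) (abs_fpWeight_le L (ε β)) (fun g => (fpWeight_mem_Icc L (ε β) g).1) u)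
      hposβ.le, ?_⟩
    have h := hrat hposβ
    linarith [h]

/-- ★★★ **THE EXACT DRESSING: the `W`-fields of `AnalyticRatePotInput` and the (B-T)-side slack.**  Under the hypotheses of `diagRatio_near_one_eventually` there are `κ ≥ 0` and
`ε_W` with `0 ≤ ε_W(β) ≤ a'λ_b(L³β)²` eventually such that the weight `W̃ β := clampW κ f̂_β (min(d_tor,½))` (`f̂_β(u) = f_β(u)/f_β(1)`) satisfies, for ALL `β` and `u`:
`IsPhys (W̃ β)`, `0 ≤ W̃ β u`, `|W̃ β u| ≤ √(1 + κ/4)`, `orbitDist u < D·recordDelta1 L (1/6) β → |W̃ β u² − 1| ≤ κ·orbitDist u²`; and eventually in `β`, on the window,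
`|W̃ β u² − f̂_β u| ≤ ε_W β`. [cite: Luscher1983, §3] -/
theorem exactDressing_fields {D cε Ξ₀ a : ℝ} (hD : 0 ≤ D) (hcε : 0 ≤ cε) (hΞ₀ : 0 ≤ Ξ₀) (Ω : ℝ → LinkSpace L → ℝ) (CΩ ε η : ℝ → ℝ)
    (hΩm : ∀ β, Measurable (Ω β)) (hCΩ : ∀ β x, |Ω β x| ≤ CΩ β) (hΩ0 : ∀ β x, 0 ≤ Ω β x) (hΩinv : ∀ β (g : SU2) (x : LinkSpace L), Ω β (adL L g x) = Ω β x)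
    (hΩc : ∀ β (v : Edge 3 L → Fin 3 → ℝ), Ω β (linkEmbed L v) ≠ 0 → v ∈ capBalancedSet L) (hε : ∀ᶠ β : ℝ in atTop, β * ε β ^ 2 ≤ cε)
    (hpos : ∀ᶠ β : ℝ in atTop, 0 < fpBOKernel L β (Ω β) (fpWeight L (ε β)) 1 1 / transferKernel su2Rep ((L : ℝ) ^ 3 * β) (1 : GaugeConfig 3 1 SU2) 1)
    (hΞ : ∀ᶠ β : ℝ in atTop, ∃ Ξ : ℝ, 0 ≤ Ξ ∧ Ξ ≤ Ξ₀ ∧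
      ∫ p in ({p : (Edge 3 L → Fin 3 → ℝ) × ((Edge 3 L → Fin 3 → ℝ) × (Site 3 L → SU2)) | β * kinDefect L (orthoTube L 1 p.1) (orthoTube L 1 p.2.1) p.2.2 ≤ β ^ ((1 : ℝ) / 8)} ∩
          {p | β * ‖linkEmbed L p.1‖ ^ 2 ≤ β ^ ((1 : ℝ) / 8)} ∩ {p | β * ‖linkEmbed L p.2.1‖ ^ 2 ≤ β ^ ((1 : ℝ) / 8)} ∩
          {p | Ω β (linkEmbed L p.1) ≠ 0 ∧ Ω β (linkEmbed L p.2.1) ≠ 0 ∧ fpWeight L (ε β) p.2.2 ≠ 0}),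
        fpTriple L β (Ω β) (fpWeight L (ε β)) 1 1 p * (1 + β * kinDefect L (orthoTube L 1 p.1) (orthoTube L 1 p.2.1) p.2.2 + β * ‖linkEmbed L p.1‖ ^ 2 + β * ‖linkEmbed L p.2.1‖ ^ 2) ^ 4
        ∂((orthoTransverse L).prod ((orthoTransverse L).prod (gaugeMeasure L))) ≤
      Ξ * ∫ p, fpTriple L β (Ω β) (fpWeight L (ε β)) 1 1 p ∂((orthoTransverse L).prod ((orthoTransverse L).prod (gaugeMeasure L))))
    (hη1 : ∀ᶠ β : ℝ in atTop,
      ∫ p in ({p : (Edge 3 L → Fin 3 → ℝ) × ((Edge 3 L → Fin 3 → ℝ) × (Site 3 L → SU2)) | β * kinDefect L (orthoTube L 1 p.1) (orthoTube L 1 p.2.1) p.2.2 ≤ β ^ ((1 : ℝ) / 8)} ∩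
          {p | β * ‖linkEmbed L p.1‖ ^ 2 ≤ β ^ ((1 : ℝ) / 8)} ∩ {p | β * ‖linkEmbed L p.2.1‖ ^ 2 ≤ β ^ ((1 : ℝ) / 8)} ∩
          {p | Ω β (linkEmbed L p.1) ≠ 0 ∧ Ω β (linkEmbed L p.2.1) ≠ 0 ∧ fpWeight L (ε β) p.2.2 ≠ 0})ᶜ,
        fpTriple L β (Ω β) (fpWeight L (ε β)) 1 1 p ∂((orthoTransverse L).prod ((orthoTransverse L).prod (gaugeMeasure L))) ≤
      η β * ∫ p, fpTriple L β (Ω β) (fpWeight L (ε β)) 1 1 p ∂((orthoTransverse L).prod ((orthoTransverse L).prod (gaugeMeasure L))))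
    (hηu : ∀ᶠ β : ℝ in atTop, ∀ u : GaugeConfig 3 1 SU2, orbitDist u < D * recordDelta1 L (1 / 6) β → ∀ d : SU2,
      (∫ p in ({p : (Edge 3 L → Fin 3 → ℝ) × ((Edge 3 L → Fin 3 → ℝ) × (Site 3 L → SU2)) | β * kinDefect L (orthoTube L 1 p.1) (orthoTube L 1 p.2.1) p.2.2 ≤ β ^ ((1 : ℝ) / 8)} ∩
          {p | β * ‖linkEmbed L p.1‖ ^ 2 ≤ β ^ ((1 : ℝ) / 8)} ∩ {p | β * ‖linkEmbed L p.2.1‖ ^ 2 ≤ β ^ ((1 : ℝ) / 8)} ∩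
          {p | Ω β (linkEmbed L p.1) ≠ 0 ∧ Ω β (linkEmbed L p.2.1) ≠ 0 ∧ fpWeight L (ε β) p.2.2 ≠ 0})ᶜ,
        fpTriple L β (Ω β) (fpWeight L (ε β)) (gaugeTransform (fun _ : Site 3 1 => d) u) (gaugeTransform (fun _ : Site 3 1 => d) u) p
        ∂((orthoTransverse L).prod ((orthoTransverse L).prod (gaugeMeasure L)))) / transferKernel su2Rep ((L : ℝ) ^ 3 * β) u u ≤
      η β * ((∫ p, fpTriple L β (Ω β) (fpWeight L (ε β)) 1 1 p ∂((orthoTransverse L).prod ((orthoTransverse L).prod (gaugeMeasure L)))) /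
        transferKernel su2Rep ((L : ℝ) ^ 3 * β) (1 : GaugeConfig 3 1 SU2) 1))
    (hη0 : ∀ᶠ β : ℝ in atTop, 0 ≤ η β) (hηa : ∀ᶠ β : ℝ in atTop, η β ≤ a * bareLambda ((L : ℝ) ^ 3 * β) ^ 2) :
    ∃ κ : ℝ, 0 ≤ κ ∧ ∃ εW : ℝ → ℝ, (∃ a' : ℝ, ∀ᶠ β : ℝ in atTop, εW β ≤ a' * bareLambda ((L : ℝ) ^ 3 * β) ^ 2) ∧ (∀ᶠ β : ℝ in atTop, 0 ≤ εW β) ∧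
      (∀ β, IsPhys (clampW κ (fun u : GaugeConfig 3 1 SU2 => fpBOKernel L β (Ω β) (fpWeight L (ε β)) u u / transferKernel su2Rep ((L : ℝ) ^ 3 * β) u u /
          (fpBOKernel L β (Ω β) (fpWeight L (ε β)) 1 1 / transferKernel su2Rep ((L : ℝ) ^ 3 * β) (1 : GaugeConfig 3 1 SU2) 1))
        (fun U : GaugeConfig 3 1 SU2 => min (torDist U) (1 / 2)))) ∧
      (∀ β u, 0 ≤ clampW κ (fun u : GaugeConfig 3 1 SU2 => fpBOKernel L β (Ω β) (fpWeight L (ε β)) u u / transferKernel su2Rep ((L : ℝ) ^ 3 * β) u u /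
          (fpBOKernel L β (Ω β) (fpWeight L (ε β)) 1 1 / transferKernel su2Rep ((L : ℝ) ^ 3 * β) (1 : GaugeConfig 3 1 SU2) 1))
        (fun U : GaugeConfig 3 1 SU2 => min (torDist U) (1 / 2)) u) ∧
      (∀ β u, |clampW κ (fun u : GaugeConfig 3 1 SU2 => fpBOKernel L β (Ω β) (fpWeight L (ε β)) u u / transferKernel su2Rep ((L : ℝ) ^ 3 * β) u u /
          (fpBOKernel L β (Ω β) (fpWeight L (ε β)) 1 1 / transferKernel su2Rep ((L : ℝ) ^ 3 * β) (1 : GaugeConfig 3 1 SU2) 1))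
        (fun U : GaugeConfig 3 1 SU2 => min (torDist U) (1 / 2)) u| ≤ Real.sqrt (1 + κ / 4)) ∧
      (∀ β u, orbitDist u < D * recordDelta1 L (1 / 6) β →
        |clampW κ (fun u : GaugeConfig 3 1 SU2 => fpBOKernel L β (Ω β) (fpWeight L (ε β)) u u / transferKernel su2Rep ((L : ℝ) ^ 3 * β) u u /
          (fpBOKernel L β (Ω β) (fpWeight L (ε β)) 1 1 / transferKernel su2Rep ((L : ℝ) ^ 3 * β) (1 : GaugeConfig 3 1 SU2) 1))
        (fun U : GaugeConfig 3 1 SU2 => min (torDist U) (1 / 2)) u ^ 2 - 1| ≤ κ * orbitDist u ^ 2) ∧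
      (∀ᶠ β : ℝ in atTop, ∀ u : GaugeConfig 3 1 SU2, orbitDist u < D * recordDelta1 L (1 / 6) β →
        |clampW κ (fun u : GaugeConfig 3 1 SU2 => fpBOKernel L β (Ω β) (fpWeight L (ε β)) u u / transferKernel su2Rep ((L : ℝ) ^ 3 * β) u u /
          (fpBOKernel L β (Ω β) (fpWeight L (ε β)) 1 1 / transferKernel su2Rep ((L : ℝ) ^ 3 * β) (1 : GaugeConfig 3 1 SU2) 1))
        (fun U : GaugeConfig 3 1 SU2 => min (torDist U) (1 / 2)) u ^ 2 -
          fpBOKernel L β (Ω β) (fpWeight L (ε β)) u u / transferKernel su2Rep ((L : ℝ) ^ 3 * β) u u /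
            (fpBOKernel L β (Ω β) (fpWeight L (ε β)) 1 1 / transferKernel su2Rep ((L : ℝ) ^ 3 * β) (1 : GaugeConfig 3 1 SU2) 1)| ≤ εW β) := by
  obtain ⟨κ, hκ, εW, hεWa, hεW0, hnear⟩ := diagRatio_near_one_eventually (L := L) hD hcε hΞ₀ Ω CΩ ε η hΩm hCΩ hΩ0 hΩinv hΩc hε hpos hΞ hη1 hηu hη0 hηa
  -- the window is inside `{orbitDist < 1/2}` eventually
  have hδ : ∀ᶠ β : ℝ in atTop, D * recordDelta1 L (1 / 6) β ≤ 1 / 2 := by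
    filter_upwards [diag_numerology_eventually (L := L) (K₁ := 0) (K₂ := 0) hD le_rfl le_rfl] with β hβ
    linarith [hβ.2.2.2.1]
  -- the family `f̂_β` is measurable, colour and twist invariant for every `β`
  have hfm : ∀ β, Measurable (fun u : GaugeConfig 3 1 SU2 => fpBOKernel L β (Ω β) (fpWeight L (ε β)) u u / transferKernel su2Rep ((L : ℝ) ^ 3 * β) u u /
      (fpBOKernel L β (Ω β) (fpWeight L (ε β)) 1 1 / transferKernel su2Rep ((L : ℝ) ^ 3 * β) (1 : GaugeConfig 3 1 SU2) 1)) := fun β =>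
    (measurable_diagRatio β (hΩm β) (hCΩ β) (measurable_fpWeight L (ε β)) (abs_fpWeight_le L (ε β))).div_const _
  have hfg : ∀ β (g : Site 3 1 → SU2) (u : GaugeConfig 3 1 SU2),
      fpBOKernel L β (Ω β) (fpWeight L (ε β)) (gaugeTransform g u) (gaugeTransform g u) / transferKernel su2Rep ((L : ℝ) ^ 3 * β) (gaugeTransform g u) (gaugeTransform g u) /
          (fpBOKernel L β (Ω β) (fpWeight L (ε β)) 1 1 / transferKernel su2Rep ((L : ℝ) ^ 3 * β) (1 : GaugeConfig 3 1 SU2) 1) =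
        fpBOKernel L β (Ω β) (fpWeight L (ε β)) u u / transferKernel su2Rep ((L : ℝ) ^ 3 * β) u u /
          (fpBOKernel L β (Ω β) (fpWeight L (ε β)) 1 1 / transferKernel su2Rep ((L : ℝ) ^ 3 * β) (1 : GaugeConfig 3 1 SU2) 1) := fun β g u => by
    rw [diagRatio_gaugeTransform β (hΩm β) (hΩinv β) (measurable_fpWeight L (ε β)) (fun c g => fpWeight_conj (ε β) c g) g u]
  have hft : ∀ β (k : Fin 3), ∀ z ∈ Subgroup.center SU2, ∀ u : GaugeConfig 3 1 SU2,
      fpBOKernel L β (Ω β) (fpWeight L (ε β)) (twist k z u) (twist k z u) / transferKernel su2Rep ((L : ℝ) ^ 3 * β) (twist k z u) (twist k z u) /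
          (fpBOKernel L β (Ω β) (fpWeight L (ε β)) 1 1 / transferKernel su2Rep ((L : ℝ) ^ 3 * β) (1 : GaugeConfig 3 1 SU2) 1) =
        fpBOKernel L β (Ω β) (fpWeight L (ε β)) u u / transferKernel su2Rep ((L : ℝ) ^ 3 * β) u u /
          (fpBOKernel L β (Ω β) (fpWeight L (ε β)) 1 1 / transferKernel su2Rep ((L : ℝ) ^ 3 * β) (1 : GaugeConfig 3 1 SU2) 1) := fun β k z hz u => by
    rw [diagRatio_twist β (Ω β) (fpWeight L (ε β)) k hz u]
  obtain ⟨h1, h2, h3, h4, h5⟩ := dressedWeight_fields (f := fun β u => fpBOKernel L β (Ω β) (fpWeight L (ε β)) u u / transferKernel su2Rep ((L : ℝ) ^ 3 * β) u u /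
      (fpBOKernel L β (Ω β) (fpWeight L (ε β)) 1 1 / transferKernel su2Rep ((L : ℝ) ^ 3 * β) (1 : GaugeConfig 3 1 SU2) 1)) hfm hfg hft (le_refl κ) hκ hδ hεW0 hnear
  exact ⟨κ, hκ, εW, hεWa, hεW0, h1, h2, h3, h4, h5⟩

end Summit.QuantumFields.YangMills.Theorems.FemtoTransferGap.RateTube

end
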